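import Mathlib
import HarnessLib

/-!
# The discrete Hardy inequality on the lattice `ℤ^d`, `d ≥ 3`

Topic `Literature/Analysis/FunctionSpaces` (support file: theorems only, no definitions, no named facts).

For `d ≥ 3` and a finitely supported `f : ℤ^d → ℝ` (sites `Fin d → ℤ`, unit vectors `e_i = Pi.single i 1`, `|x|² = ∑_i x_i²`):

  `∑_x f(x)² / (|x|² + 3d) ≤ (128/(d−2)²) · ∑_x ∑_i (f(x+e_i) − f(x))²`            (`discrete_hardy_lattice`),
  `∑_{x≠0} f(x)² / |x|²   ≤ (128(3d+1)/(d−2)²) · ∑_x ∑_i (f(x+e_i) − f(x))²      (`discrete_hardy_lattice_punctured`),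

the lattice analogue of Hardy's inequality `∫ |u|²/|x|² ≤ (4/(d−2)²) ∫ |∇u|²`.  The printed statement is L. Kapitanski,
A. Laptev, *J. Spectral Theory* 6 (2016), Theorem 3.1 p. 843: «Let `d ≥ 3`. For a function `f` defined on `ℤ^d` we have
`∑_{n∈ℤ^d} |f(n)|²/|n|² ≤ C ∑_{n∈ℤ^d} ∑_{j=1}^d |f(n) − f(n − 1_j)|²» with an explicit `C(d)` (Fourier proof; earlier G. Rozenblum,
M. Solomyak, *J. Math. Sci.* 159 (2009)).  The constants here are not optimal.

PROOF — the ground-state ∕ vector-field argument of the continuous case (Kapitanski–Laptev §2: «the multidimensional Hardy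
inequality is intimately related to the fundamental solution of the Laplace equation») run on the lattice, with NO Fourier analysis:
for `n(x) = |x|² + 3d` and the bond field `V(x,i) = (2x_i + 1)/(n(x) + n(x+e_i))` (a discretisation of `x/|x|² = ∇ ½log|x|²`),
* `∑_i (V(x,i) − V(x−e_i,i)) ≥ (d−2)/(2 n(x))`  (private `hardyField_div_lower`: one coordinate at a time a concave quadratic,
  `hardy_term_lower`, then the summed main term `hardy_main_lower`),
* `∑_i (V(x,i)² + V(x−e_i,i)²) ≤ 16/n(x)`       (private `hardyField_sq_upper`),
summation by parts on the finite support (`sum_shift_sq`: `∑_x w(x) f(x+v)² = ∑_x w(x−v) f(x)²`), and Young's inequality: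
`((d−2)/2)·A ≤ ∑ f² div V = −∑ V·(f(·+e)² − f²) ≤ D/(2λ) + 16λ·A` for `A = ∑ f²/n`, `D = ∑|∇f|²`; `λ = (d−2)/64` gives `A ≤ 128 D/(d−2)²`.
The letters are stated for ANY functions `nrm`, `V` satisfying the two defining equations (so the assembly never unfolds them).
Mathlib has no discrete Hardy inequality; the tree's `HardyInequalityAverage/Tail`, `TorusLineHardy`, `TorusPairTubeHardy` are continuum.
-/

noncomputable section

open Finset
open scoped BigOperators

namespace Literature.Analysis.FunctionSpaces

/-! ### §1. Real algebra, one coordinate at a time -/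

/-- For `n ≥ 9`, `t² ≤ n − 9`: `(2(2n+1) − 8t²)/(2n+1)² − 2/n² ≤ (2t+1)/(2n+2t+1) − (2t−1)/(2n−2t+1)`
(cleared of denominators: a concave quadratic in `s = t²`, nonnegative at `s = 0` and `s = n`). [folklore] -/
private theorem hardy_term_lower {n t : ℝ} (hn : 9 ≤ n) (ht : t ^ 2 ≤ n - 9) :
    (2 * (2 * n + 1) - 8 * t ^ 2) / (2 * n + 1) ^ 2 - 2 / n ^ 2
      ≤ (2 * t + 1) / (2 * n + 2 * t + 1) - (2 * t - 1) / (2 * n - 2 * t + 1) := by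
  have hn0 : 0 < n := by linarith
  have htabs : t ≤ t ^ 2 + 1 ∧ -t ≤ t ^ 2 + 1 := ⟨by nlinarith [sq_nonneg (t - 1/2)], by nlinarith [sq_nonneg (t + 1/2)]⟩
  have h1 : 0 < 2 * n + 2 * t + 1 := by nlinarith
  have h2 : 0 < 2 * n - 2 * t + 1 := by nlinarith
  have hP : 0 < (2 * n + 1) ^ 2 := by positivity
  have hn2 : 0 < n ^ 2 := by positivity
  have hD : (2 * n + 2 * t + 1) * (2 * n - 2 * t + 1) = (2 * n + 1) ^ 2 - 4 * t ^ 2 := by ring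
  have hDpos : 0 < (2 * n + 1) ^ 2 - 4 * t ^ 2 := by rw [← hD]; exact mul_pos h1 h2
  -- the key polynomial inequality in `s = t²`: `n·q(s) = (n−s)·q(0) + s·q(n) + 32n³s(n−s) ≥ 0`
  have key : 0 ≤ (4 * n + 2 - 8 * t ^ 2) * n ^ 2 * (4 * t ^ 2) + 2 * (2 * n + 1) ^ 2 * ((2 * n + 1) ^ 2 - 4 * t ^ 2) := by
    have e : n * ((4 * n + 2 - 8 * t ^ 2) * n ^ 2 * (4 * t ^ 2) + 2 * (2 * n + 1) ^ 2 * ((2 * n + 1) ^ 2 - 4 * t ^ 2))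
        = (n - t ^ 2) * (2 * ((2 * n + 1) ^ 2) ^ 2) + t ^ 2 * (16 * n ^ 4 + 40 * n ^ 3 + 16 * n ^ 2 + 8 * n + 2)
          + 32 * n ^ 3 * t ^ 2 * (n - t ^ 2) := by ring
    have ha : 0 ≤ (n - t ^ 2) * (2 * ((2 * n + 1) ^ 2) ^ 2) := mul_nonneg (by linarith) (by positivity)
    have hb : 0 ≤ t ^ 2 * (16 * n ^ 4 + 40 * n ^ 3 + 16 * n ^ 2 + 8 * n + 2) := mul_nonneg (sq_nonneg t) (by positivity)
    have hc : 0 ≤ 32 * n ^ 3 * t ^ 2 * (n - t ^ 2) := mul_nonneg (by positivity) (by linarith)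
    refine le_of_mul_le_mul_left ?_ hn0
    rw [mul_zero, e]; linarith
  have hL : (2 * (2 * n + 1) - 8 * t ^ 2) / (2 * n + 1) ^ 2 - 2 / n ^ 2
      = ((2 * (2 * n + 1) - 8 * t ^ 2) * n ^ 2 - 2 * (2 * n + 1) ^ 2) / ((2 * n + 1) ^ 2 * n ^ 2) := by
    rw [div_sub_div _ _ hP.ne' hn2.ne']; ring
  have hR : (2 * t + 1) / (2 * n + 2 * t + 1) - (2 * t - 1) / (2 * n - 2 * t + 1)
      = (4 * n + 2 - 8 * t ^ 2) / ((2 * n + 1) ^ 2 - 4 * t ^ 2) := by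
    rw [div_sub_div _ _ h1.ne' h2.ne', hD]
    congr 1; ring
  rw [hL, hR, div_le_div_iff₀ (mul_pos hP hn2) hDpos]
  nlinarith [key]

/-- For `n ≥ 9`, `t² ≤ n − 9`: `((2t+1)/(2n+2t+1))² + ((2t−1)/(2n−2t+1))² ≤ 2(8t² + 2)/(n+1)²`. [folklore] -/
private theorem hardy_term_sq_upper {n t : ℝ} (hn : 9 ≤ n) (ht : t ^ 2 ≤ n - 9) :
    ((2 * t + 1) / (2 * n + 2 * t + 1)) ^ 2 + ((2 * t - 1) / (2 * n - 2 * t + 1)) ^ 2 ≤ 2 * (8 * t ^ 2 + 2) / (n + 1) ^ 2 := by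
  have htabs : t ≤ t ^ 2 + 1 ∧ -t ≤ t ^ 2 + 1 := ⟨by nlinarith [sq_nonneg (t - 1/2)], by nlinarith [sq_nonneg (t + 1/2)]⟩
  have hn1 : 0 < n + 1 := by linarith
  have hb : ∀ u : ℝ, n + 1 ≤ 2 * n + 2 * u + 1 → (2 * u + 1) ^ 2 ≤ 8 * u ^ 2 + 2 →
      ((2 * u + 1) / (2 * n + 2 * u + 1)) ^ 2 ≤ (8 * u ^ 2 + 2) / (n + 1) ^ 2 := by
    intro u hu hsq
    rw [div_pow, div_le_div_iff₀ (pow_pos (lt_of_lt_of_le hn1 hu) 2) (pow_pos hn1 2)]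
    have : (n + 1) ^ 2 ≤ (2 * n + 2 * u + 1) ^ 2 := pow_le_pow_left₀ hn1.le hu 2
    nlinarith [this, hsq, sq_nonneg (2 * u + 1)]
  have hb1 := hb t (by nlinarith) (by nlinarith [sq_nonneg (2 * t - 1)])
  have hb2 := hb (-t) (by nlinarith) (by nlinarith [sq_nonneg (2 * t + 1)])
  have e1 : (2 * -t + 1) / (2 * n + 2 * -t + 1) = -((2 * t - 1) / (2 * n - 2 * t + 1)) := by
    rw [← neg_div]; congr 1 <;> ring
  rw [e1, neg_sq, show 8 * (-t) ^ 2 + 2 = 8 * t ^ 2 + 2 by ring] at hb2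
  calc ((2 * t + 1) / (2 * n + 2 * t + 1)) ^ 2 + ((2 * t - 1) / (2 * n - 2 * t + 1)) ^ 2
      ≤ (8 * t ^ 2 + 2) / (n + 1) ^ 2 + (8 * t ^ 2 + 2) / (n + 1) ^ 2 := add_le_add hb1 hb2
    _ = 2 * (8 * t ^ 2 + 2) / (n + 1) ^ 2 := by ring

/-- For `d ≥ 3`, `n ≥ 9`: `(d−2)/(2n) ≤ ((4d−8)n + 26d)/(2n+1)² − 2d/n²`. [folklore] -/
private theorem hardy_main_lower {d : ℕ} (hd : 3 ≤ d) {n : ℝ} (hn : 9 ≤ n) :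
    ((d : ℝ) - 2) / (2 * n) ≤ ((4 * (d : ℝ) - 8) * n + 26 * d) / (2 * n + 1) ^ 2 - 2 * d / n ^ 2 := by
  have hd3 : (3 : ℝ) ≤ d := by exact_mod_cast hd
  have hn0 : 0 < n := by linarith
  have hP : 0 < (2 * n + 1) ^ 2 := by positivity
  have hn2 : 0 < n ^ 2 := by positivity
  have hpoly : 0 ≤ (4 * (d : ℝ) - 8) * n ^ 3 + (32 * d + 8) * n ^ 2 - (17 * d - 2) * n - 4 * d := by
    have h1 : 0 ≤ (4 * (d : ℝ) - 8) * n ^ 3 := mul_nonneg (by linarith) (by positivity)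
    have h2 : 0 ≤ (32 * (d : ℝ) + 8) * (n * (n - 9)) := mul_nonneg (by linarith) (mul_nonneg hn0.le (by linarith))
    nlinarith [h1, h2]
  rw [div_sub_div _ _ hP.ne' hn2.ne', div_le_div_iff₀ (by positivity) (mul_pos hP hn2)]
  nlinarith [mul_nonneg hn0.le hpoly, mul_nonneg (mul_nonneg hn0.le hn0.le) hpoly]

/-! ### §2. The lattice letters of the Hardy field -/

variable {d : ℕ}

/-- `|x + e_i|² = |x|² + 2x_i + 1`. [folklore] -/
private theorem sum_sq_add_single (x : Fin d → ℤ) (i : Fin d) :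
    ∑ j, (((x + Pi.single i (1 : ℤ) : Fin d → ℤ) j : ℤ) : ℝ) ^ 2 = (∑ j, ((x j : ℤ) : ℝ) ^ 2) + 2 * (x i : ℝ) + 1 := by
  have h : ∀ j, (((x + Pi.single i (1 : ℤ) : Fin d → ℤ) j : ℤ) : ℝ) ^ 2 = ((x j : ℤ) : ℝ) ^ 2 + if j = i then 2 * (x i : ℝ) + 1 else 0 := by
    intro j
    by_cases hj : j = i
    · subst hj; simp; ring
    · simp [hj]
  simp_rw [h, Finset.sum_add_distrib, Finset.sum_ite_eq', Finset.mem_univ, if_true]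
  ring

section Letters

variable (nrm : (Fin d → ℤ) → ℝ) (V : (Fin d → ℤ) → Fin d → ℝ)
  (hnrm : ∀ x, nrm x = (∑ j, ((x j : ℤ) : ℝ) ^ 2) + 3 * d)
  (hV : ∀ x i, V x i = (2 * ((x i : ℤ) : ℝ) + 1) / (nrm x + nrm (x + Pi.single i (1 : ℤ))))

include hnrm in
/-- `n(x + e_i) = n(x) + 2x_i + 1` and `n(x − e_i) = n(x) − 2x_i + 1` for `n(x) = |x|² + 3d`. [folklore] -/
private theorem nrm_shift (x : Fin d → ℤ) (i : Fin d) :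
    nrm (x + Pi.single i (1 : ℤ)) = nrm x + 2 * ((x i : ℤ) : ℝ) + 1 ∧ nrm (x - Pi.single i (1 : ℤ)) = nrm x - 2 * ((x i : ℤ) : ℝ) + 1 := by
  refine ⟨by rw [hnrm, hnrm x, sum_sq_add_single]; ring, ?_⟩
  have h := sum_sq_add_single (x - Pi.single i (1 : ℤ)) i
  rw [sub_add_cancel] at h
  have e1 : (((x - Pi.single i (1 : ℤ) : Fin d → ℤ) i : ℤ) : ℝ) = ((x i : ℤ) : ℝ) - 1 := by simp
  rw [hnrm, hnrm x, h, e1]; ring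

include hnrm in
/-- `9 ≤ n(x)` and `x_i² ≤ n(x) − 9` (`d ≥ 3`). [folklore] -/
private theorem nrm_facts (hd : 3 ≤ d) (x : Fin d → ℤ) (i : Fin d) : 9 ≤ nrm x ∧ ((x i : ℤ) : ℝ) ^ 2 ≤ nrm x - 9 := by
  have hd3 : (3 : ℝ) ≤ d := by exact_mod_cast hd
  have hi : ((x i : ℤ) : ℝ) ^ 2 ≤ ∑ j, ((x j : ℤ) : ℝ) ^ 2 :=
    Finset.single_le_sum (fun k _ => sq_nonneg ((x k : ℤ) : ℝ)) (Finset.mem_univ i)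
  have h0 : 0 ≤ ((x i : ℤ) : ℝ) ^ 2 := sq_nonneg _
  rw [hnrm]
  constructor <;> linarith

include hnrm hV in
/-- **The divergence letter**: `(d − 2)/(2 n(x)) ≤ ∑_i (V(x,i) − V(x − e_i, i))` (`d ≥ 3`). [folklore] -/
private theorem hardyField_div_lower (hd : 3 ≤ d) (x : Fin d → ℤ) :
    ((d : ℝ) - 2) / (2 * nrm x) ≤ ∑ i, (V x i - V (x - Pi.single i (1 : ℤ)) i) := by
  haveI : NeZero d := ⟨by omega⟩
  have hn9 : 9 ≤ nrm x := (nrm_facts nrm hnrm hd x 0).1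
  have hterm : ∀ i : Fin d, V x i - V (x - Pi.single i (1 : ℤ)) i
      = (2 * ((x i : ℤ) : ℝ) + 1) / (2 * nrm x + 2 * ((x i : ℤ) : ℝ) + 1) - (2 * ((x i : ℤ) : ℝ) - 1) / (2 * nrm x - 2 * ((x i : ℤ) : ℝ) + 1) := by
    intro i
    obtain ⟨hp, hm⟩ := nrm_shift nrm hnrm x i
    have e1 : (((x - Pi.single i (1 : ℤ) : Fin d → ℤ) i : ℤ) : ℝ) = ((x i : ℤ) : ℝ) - 1 := by simp
    rw [hV, hV, sub_add_cancel, hp, hm, e1]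
    congr 1
    · congr 1; ring
    · congr 1 <;> ring
  have hcoord : ∀ i : Fin d, (2 * (2 * nrm x + 1) - 8 * ((x i : ℤ) : ℝ) ^ 2) / (2 * nrm x + 1) ^ 2 - 2 / nrm x ^ 2
      ≤ V x i - V (x - Pi.single i (1 : ℤ)) i := fun i => by
    rw [hterm]; exact hardy_term_lower hn9 (nrm_facts nrm hnrm hd x i).2
  refine le_trans ?_ (Finset.sum_le_sum fun i _ => hcoord i)
  rw [Finset.sum_sub_distrib, Finset.sum_const, Finset.card_univ, Fintype.card_fin, ← Finset.sum_div, Finset.sum_sub_distrib,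
    Finset.sum_const, Finset.card_univ, Fintype.card_fin, ← Finset.mul_sum]
  have hsum : ∑ i, ((x i : ℤ) : ℝ) ^ 2 = nrm x - 3 * d := by rw [hnrm]; ring
  rw [hsum]
  have e : ((d : ℕ) • (2 * (2 * nrm x + 1)) - 8 * (nrm x - 3 * (d : ℝ))) / (2 * nrm x + 1) ^ 2 - (d : ℕ) • (2 / nrm x ^ 2)
      = ((4 * (d : ℝ) - 8) * nrm x + 26 * d) / (2 * nrm x + 1) ^ 2 - 2 * d / nrm x ^ 2 := by
    simp only [nsmul_eq_mul]
    have hn0 : nrm x ≠ 0 := by linarith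
    field_simp
    ring
  rw [e]
  exact hardy_main_lower hd hn9

include hnrm hV in
/-- **The size letter**: `∑_i (V(x,i)² + V(x − e_i,i)²) ≤ 16 / n(x)` (`d ≥ 3`). [folklore] -/
private theorem hardyField_sq_upper (hd : 3 ≤ d) (x : Fin d → ℤ) :
    ∑ i, (V x i ^ 2 + V (x - Pi.single i (1 : ℤ)) i ^ 2) ≤ 16 / nrm x := by
  haveI : NeZero d := ⟨by omega⟩
  have hd3 : (3 : ℝ) ≤ d := by exact_mod_cast hd
  have hn9 : 9 ≤ nrm x := (nrm_facts nrm hnrm hd x 0).1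
  have hcoord : ∀ i : Fin d, V x i ^ 2 + V (x - Pi.single i (1 : ℤ)) i ^ 2 ≤ 2 * (8 * ((x i : ℤ) : ℝ) ^ 2 + 2) / (nrm x + 1) ^ 2 := by
    intro i
    obtain ⟨hp, hm⟩ := nrm_shift nrm hnrm x i
    have e1 : (((x - Pi.single i (1 : ℤ) : Fin d → ℤ) i : ℤ) : ℝ) = ((x i : ℤ) : ℝ) - 1 := by simp
    have e : V x i ^ 2 + V (x - Pi.single i (1 : ℤ)) i ^ 2 = ((2 * ((x i : ℤ) : ℝ) + 1) / (2 * nrm x + 2 * ((x i : ℤ) : ℝ) + 1)) ^ 2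
        + ((2 * ((x i : ℤ) : ℝ) - 1) / (2 * nrm x - 2 * ((x i : ℤ) : ℝ) + 1)) ^ 2 := by
      rw [hV, hV, sub_add_cancel, hp, hm, e1]
      congr 1
      · congr 1; congr 1; ring
      · congr 1; congr 1 <;> ring
    rw [e]; exact hardy_term_sq_upper hn9 (nrm_facts nrm hnrm hd x i).2
  refine (Finset.sum_le_sum fun i _ => hcoord i).trans ?_
  rw [← Finset.sum_div]
  have hsum : ∑ i, 2 * (8 * ((x i : ℤ) : ℝ) ^ 2 + 2) = 16 * (nrm x - 3 * d) + 4 * d := by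
    rw [← Finset.mul_sum, Finset.sum_add_distrib, Finset.sum_const, Finset.card_univ, Fintype.card_fin, ← Finset.mul_sum]
    have : ∑ i, ((x i : ℤ) : ℝ) ^ 2 = nrm x - 3 * d := by rw [hnrm]; ring
    rw [this]; simp only [nsmul_eq_mul]; ring
  rw [hsum, div_le_div_iff₀ (by positivity) (by linarith)]
  nlinarith

end Letters

/-! ### §3. Summation by parts on a finite support -/

/-- If `f` vanishes off `T`, `T ⊆ S` and `T − v ⊆ S`, then `∑_{x∈S} w(x) f(x+v)² = ∑_{x∈S} w(x−v) f(x)²`. [folklore] -/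
private theorem sum_shift_sq {f : (Fin d → ℤ) → ℝ} {S T : Finset (Fin d → ℤ)} (hT : ∀ x, f x ≠ 0 → x ∈ T) (hTS : T ⊆ S)
    (v : Fin d → ℤ) (hTS' : ∀ y ∈ T, y - v ∈ S) (w : (Fin d → ℤ) → ℝ) :
    ∑ x ∈ S, w x * f (x + v) ^ 2 = ∑ x ∈ S, w (x - v) * f x ^ 2 := by
  classical
  have hR : ∑ x ∈ S, w (x - v) * f x ^ 2 = ∑ y ∈ T, w (y - v) * f y ^ 2 := by
    refine (Finset.sum_subset hTS fun x _ hxT => ?_).symm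
    have : f x = 0 := by by_contra h; exact hxT (hT x h)
    simp [this]
  have hinj : Set.InjOn (fun y : Fin d → ℤ => y - v) ↑T := fun a _ b _ h => sub_left_injective h
  have hsub : T.image (fun y => y - v) ⊆ S := fun x hx => by
    obtain ⟨y, hy, rfl⟩ := Finset.mem_image.mp hx
    exact hTS' y hy
  rw [hR, ← Finset.sum_subset hsub, Finset.sum_image hinj]
  · exact Finset.sum_congr rfl fun y _ => by rw [sub_add_cancel]
  · intro x _ hx
    have : f (x + v) = 0 := by
      by_contra h
      exact hx (Finset.mem_image.mpr ⟨x + v, hT _ h, add_sub_cancel_right x v⟩)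
    simp [this]

/-- Double-sum form of `sum_shift_sq` with a bond weight `w(x,i)` and the shifts `e_i`. [folklore] -/
private theorem sum_sum_shift_sq {f : (Fin d → ℤ) → ℝ} {S T : Finset (Fin d → ℤ)} (hT : ∀ x, f x ≠ 0 → x ∈ T) (hTS : T ⊆ S)
    (hminus : ∀ y ∈ T, ∀ i : Fin d, y - Pi.single i (1 : ℤ) ∈ S) (w : (Fin d → ℤ) → Fin d → ℝ) :
    ∑ x ∈ S, ∑ i, w x i * f (x + Pi.single i (1 : ℤ)) ^ 2 = ∑ x ∈ S, ∑ i, w (x - Pi.single i (1 : ℤ)) i * f x ^ 2 := by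
  rw [Finset.sum_comm]
  conv_rhs => rw [Finset.sum_comm]
  exact Finset.sum_congr rfl fun i _ => sum_shift_sq hT hTS (Pi.single i (1 : ℤ)) (fun y hy => hminus y hy i) (fun x => w x i)

/-! ### §4. The discrete Hardy inequality -/

/-- **THE DISCRETE HARDY INEQUALITY ON `ℤ^d`, `d ≥ 3` (finite-set form, regularised weight).**  For `f : ℤ^d → ℝ` vanishing off a
finite set `T`, and any finite `S ⊇ T ∪ ⋃_i (T − e_i)`: `∑_{x∈S} f(x)²/(|x|² + 3d) ≤ (128/(d−2)²)·∑_{x∈S} ∑_i (f(x+e_i) − f(x))²`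
(a variant of the printed sharp-weight inequality, same order of singularity). [cite: KapitanskiLaptev2016, Theorem 3.1 p.843] -/
theorem discrete_hardy_lattice_finset (hd : 3 ≤ d) (f : (Fin d → ℤ) → ℝ) (T S : Finset (Fin d → ℤ))
    (hT : ∀ x, f x ≠ 0 → x ∈ T) (hTS : T ⊆ S) (hminus : ∀ y ∈ T, ∀ i : Fin d, y - Pi.single i (1 : ℤ) ∈ S) :
    ∑ x ∈ S, f x ^ 2 / ((∑ j, ((x j : ℤ) : ℝ) ^ 2) + 3 * d)
      ≤ 128 / ((d : ℝ) - 2) ^ 2 * ∑ x ∈ S, ∑ i, (f (x + Pi.single i (1 : ℤ)) - f x) ^ 2 := by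
  classical
  have hd3 : (3 : ℝ) ≤ d := by exact_mod_cast hd
  -- opaque abbreviations `nrm`, `V` with their defining equations
  obtain ⟨nrm, hnrm⟩ : ∃ g : (Fin d → ℤ) → ℝ, ∀ x, g x = (∑ j, ((x j : ℤ) : ℝ) ^ 2) + 3 * d := ⟨_, fun _ => rfl⟩
  obtain ⟨V, hV⟩ : ∃ W : (Fin d → ℤ) → Fin d → ℝ,
      ∀ x i, W x i = (2 * ((x i : ℤ) : ℝ) + 1) / (nrm x + nrm (x + Pi.single i (1 : ℤ))) := ⟨_, fun _ _ => rfl⟩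
  have hnrm0 : ∀ x, 0 < nrm x := fun x => by
    have : 0 ≤ ∑ j, ((x j : ℤ) : ℝ) ^ 2 := Finset.sum_nonneg fun j _ => sq_nonneg _
    rw [hnrm]; linarith
  rw [show ∑ x ∈ S, f x ^ 2 / ((∑ j, ((x j : ℤ) : ℝ) ^ 2) + 3 * d) = ∑ x ∈ S, f x ^ 2 / nrm x from
    Finset.sum_congr rfl fun x _ => by rw [hnrm]]
  set A : ℝ := ∑ x ∈ S, f x ^ 2 / nrm x with hA
  set D : ℝ := ∑ x ∈ S, ∑ i, (f (x + Pi.single i (1 : ℤ)) - f x) ^ 2 with hD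
  -- (1) the divergence letter against f²: ((d-2)/2)·A ≤ Σ_x Σ_i (V(x,i) − V(x−e_i,i))·f(x)²
  have h1 : ((d : ℝ) - 2) / 2 * A ≤ ∑ x ∈ S, ∑ i, (V x i - V (x - Pi.single i (1 : ℤ)) i) * f x ^ 2 := by
    rw [hA, Finset.mul_sum]
    refine Finset.sum_le_sum fun x _ => ?_
    rw [← Finset.sum_mul, show ((d : ℝ) - 2) / 2 * (f x ^ 2 / nrm x) = ((d : ℝ) - 2) / (2 * nrm x) * f x ^ 2 by
      have := (hnrm0 x).ne'; field_simp]
    exact mul_le_mul_of_nonneg_right (hardyField_div_lower nrm V hnrm hV hd x) (sq_nonneg _)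
  -- (2) summation by parts
  have h2 : ∑ x ∈ S, ∑ i, (V x i - V (x - Pi.single i (1 : ℤ)) i) * f x ^ 2
      = -∑ x ∈ S, ∑ i, V x i * (f (x + Pi.single i (1 : ℤ)) ^ 2 - f x ^ 2) := by
    have hs := sum_sum_shift_sq hT hTS hminus V
    simp_rw [sub_mul, mul_sub, Finset.sum_sub_distrib]
    rw [hs]; ring
  -- (3) Young's inequality with λ = (d-2)/64: −V(a²−b²) ≤ (a−b)²/(2λ) + λ V² (a² + b²)
  obtain ⟨lam, hlam⟩ : ∃ l : ℝ, l = ((d : ℝ) - 2) / 64 := ⟨_, rfl⟩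
  have hlam0 : 0 < lam := by rw [hlam]; linarith
  have h3 : -∑ x ∈ S, ∑ i, V x i * (f (x + Pi.single i (1 : ℤ)) ^ 2 - f x ^ 2)
      ≤ D / (2 * lam) + lam * ∑ x ∈ S, ∑ i, V x i ^ 2 * (f (x + Pi.single i (1 : ℤ)) ^ 2 + f x ^ 2) := by
    rw [hD, Finset.sum_div, Finset.mul_sum, ← Finset.sum_add_distrib, ← Finset.sum_neg_distrib]
    refine Finset.sum_le_sum fun x _ => ?_
    rw [Finset.sum_div, Finset.mul_sum, ← Finset.sum_add_distrib, ← Finset.sum_neg_distrib]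
    refine Finset.sum_le_sum fun i _ => ?_
    have hy : ∀ a b v : ℝ, -(v * (a ^ 2 - b ^ 2)) ≤ (a - b) ^ 2 / (2 * lam) + lam * (v ^ 2 * (a ^ 2 + b ^ 2)) := by
      intro a b v
      have h0 : 0 ≤ lam / 2 * (v * (a + b) + (a - b) / lam) ^ 2 := by positivity
      have e : lam / 2 * (v * (a + b) + (a - b) / lam) ^ 2
          = lam / 2 * (v ^ 2 * (a + b) ^ 2) + v * (a ^ 2 - b ^ 2) + (a - b) ^ 2 / (2 * lam) := by
        field_simp
        ring
      have hab : v ^ 2 * (a + b) ^ 2 ≤ 2 * (v ^ 2 * (a ^ 2 + b ^ 2)) := by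
        nlinarith [mul_nonneg (sq_nonneg v) (sq_nonneg (a - b))]
      nlinarith [h0, e, hab, hlam0]
    exact hy _ _ _
  -- (4) the size letter: Σ_x Σ_i V(x,i)² (f(x+e_i)² + f(x)²) ≤ 16·A
  have h4 : ∑ x ∈ S, ∑ i, V x i ^ 2 * (f (x + Pi.single i (1 : ℤ)) ^ 2 + f x ^ 2) ≤ 16 * A := by
    have hs := sum_sum_shift_sq hT hTS hminus (fun x i => V x i ^ 2)
    have e : ∑ x ∈ S, ∑ i, V x i ^ 2 * (f (x + Pi.single i (1 : ℤ)) ^ 2 + f x ^ 2)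
        = ∑ x ∈ S, (∑ i, (V x i ^ 2 + V (x - Pi.single i (1 : ℤ)) i ^ 2)) * f x ^ 2 := by
      simp_rw [mul_add, Finset.sum_mul, add_mul, Finset.sum_add_distrib]
      rw [hs]; ring
    rw [e, hA, Finset.mul_sum]
    refine Finset.sum_le_sum fun x _ => ?_
    rw [show 16 * (f x ^ 2 / nrm x) = 16 / nrm x * f x ^ 2 by ring]
    exact mul_le_mul_of_nonneg_right (hardyField_sq_upper nrm V hnrm hV hd x) (sq_nonneg _)
  -- (5) assemble: ((d-2)/2) A ≤ 32 D/(d-2) + ((d-2)/4) A  ⇒  A ≤ 128 D/(d-2)²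
  have hD0 : 0 ≤ D := Finset.sum_nonneg fun x _ => Finset.sum_nonneg fun i _ => sq_nonneg _
  have hchain : ((d : ℝ) - 2) / 2 * A ≤ D / (2 * lam) + lam * (16 * A) := by
    have s1 := (h1.trans_eq h2).trans h3
    have s2 := mul_le_mul_of_nonneg_left h4 hlam0.le
    linarith
  have hd2 : 0 < (d : ℝ) - 2 := by linarith
  have e : D / (2 * lam) = 32 * D / ((d : ℝ) - 2) := by rw [hlam]; field_simp; ring
  rw [e, hlam] at hchain
  have hfin : ((d : ℝ) - 2) / 4 * A ≤ 32 * D / ((d : ℝ) - 2) := by nlinarith [hchain]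
  have hfin' : ((d : ℝ) - 2) * (((d : ℝ) - 2) * A) ≤ 128 * D := by
    have := (div_le_div_iff₀ (by norm_num : (0:ℝ) < 4) hd2).mp (by simpa [div_mul_eq_mul_div, mul_comm] using hfin)
    nlinarith [this]
  rw [div_mul_eq_mul_div, le_div_iff₀ (by positivity)]
  nlinarith [hfin']

/-- **THE DISCRETE HARDY INEQUALITY ON `ℤ^d`, `d ≥ 3` (series form, regularised weight).**  For a finitely supported `f : ℤ^d → ℝ`,
`∑_x f(x)²/(|x|² + 3d) ≤ (128/(d−2)²)·∑_x ∑_i (f(x+e_i) − f(x))²` — both series have finitely many nonzero terms.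
[cite: KapitanskiLaptev2016, Theorem 3.1 p.843] -/
theorem discrete_hardy_lattice (hd : 3 ≤ d) (f : (Fin d → ℤ) → ℝ) (T : Finset (Fin d → ℤ)) (hT : ∀ x ∉ T, f x = 0) :
    ∑' x, f x ^ 2 / ((∑ j, ((x j : ℤ) : ℝ) ^ 2) + 3 * d)
      ≤ 128 / ((d : ℝ) - 2) ^ 2 * ∑' x, ∑ i, (f (x + Pi.single i (1 : ℤ)) - f x) ^ 2 := by
  classical
  set S : Finset (Fin d → ℤ) := T ∪ (Finset.univ.biUnion fun i : Fin d => T.image fun y => y - Pi.single i (1 : ℤ)) with hS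
  have hT' : ∀ x, f x ≠ 0 → x ∈ T := fun x hx => by by_contra h; exact hx (hT x h)
  have hTS : T ⊆ S := fun x hx => by rw [hS]; exact Finset.mem_union_left _ hx
  have hminus : ∀ y ∈ T, ∀ i : Fin d, y - Pi.single i (1 : ℤ) ∈ S := fun y hy i => by
    rw [hS]; refine Finset.mem_union_right _ ?_
    exact Finset.mem_biUnion.mpr ⟨i, Finset.mem_univ _, Finset.mem_image.mpr ⟨y, hy, rfl⟩⟩
  have hL : ∑' x, f x ^ 2 / ((∑ j, ((x j : ℤ) : ℝ) ^ 2) + 3 * d) = ∑ x ∈ S, f x ^ 2 / ((∑ j, ((x j : ℤ) : ℝ) ^ 2) + 3 * d) := by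
    refine tsum_eq_sum (s := S) fun x hx => ?_
    have : f x = 0 := hT x fun h => hx (hTS h)
    simp [this]
  have hR : ∑' x, ∑ i, (f (x + Pi.single i (1 : ℤ)) - f x) ^ 2 = ∑ x ∈ S, ∑ i, (f (x + Pi.single i (1 : ℤ)) - f x) ^ 2 := by
    refine tsum_eq_sum (s := S) fun x hx => ?_
    have hfx : f x = 0 := hT x fun h => hx (hTS h)
    refine Finset.sum_eq_zero fun i _ => ?_
    have hfxi : f (x + Pi.single i (1 : ℤ)) = 0 := by
      by_contra h
      exact hx (by simpa using hminus _ (hT' _ h) i)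
    rw [hfx, hfxi]; ring
  rw [hL, hR]
  exact discrete_hardy_lattice_finset hd f T S hT' hTS hminus

/-- **THE DISCRETE HARDY INEQUALITY, PUNCTURED SHARP-WEIGHT FORM** (the printed shape): for a finitely supported `f : ℤ^d → ℝ`, `d ≥ 3`,
`∑_{x ≠ 0} f(x)²/|x|² ≤ (128(3d+1)/(d−2)²)·∑_x ∑_i (f(x+e_i) − f(x))²` (from `discrete_hardy_lattice`: `|x|² ≥ 1` off the origin, so
`|x|⁻² ≤ (3d+1)(|x|² + 3d)⁻¹`; no condition at the origin is needed). [cite: KapitanskiLaptev2016, Theorem 3.1 p.843] -/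
theorem discrete_hardy_lattice_punctured (hd : 3 ≤ d) (f : (Fin d → ℤ) → ℝ) (T : Finset (Fin d → ℤ)) (hT : ∀ x ∉ T, f x = 0) :
    ∑' x, (if x = 0 then (0 : ℝ) else f x ^ 2 / ∑ j, ((x j : ℤ) : ℝ) ^ 2)
      ≤ 128 * (3 * d + 1) / ((d : ℝ) - 2) ^ 2 * ∑' x, ∑ i, (f (x + Pi.single i (1 : ℤ)) - f x) ^ 2 := by
  classical
  have hd3 : (3 : ℝ) ≤ d := by exact_mod_cast hd
  -- termwise comparison of the two weights off the origin
  have hterm : ∀ x : Fin d → ℤ, (if x = 0 then (0 : ℝ) else f x ^ 2 / ∑ j, ((x j : ℤ) : ℝ) ^ 2)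
      ≤ (3 * (d : ℝ) + 1) * (f x ^ 2 / ((∑ j, ((x j : ℤ) : ℝ) ^ 2) + 3 * d)) := by
    intro x
    have hS0 : 0 ≤ ∑ j, ((x j : ℤ) : ℝ) ^ 2 := Finset.sum_nonneg fun j _ => sq_nonneg _
    split_ifs with hx
    · exact mul_nonneg (by linarith) (div_nonneg (sq_nonneg _) (by linarith))
    · obtain ⟨j, hj⟩ := Function.ne_iff.mp hx
      have hj' : (x j : ℤ) ≠ 0 := by simpa using hj
      have h1 : (1 : ℝ) ≤ ∑ k, ((x k : ℤ) : ℝ) ^ 2 :=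
        ((one_le_sq_iff_one_le_abs _).mpr (by exact_mod_cast Int.one_le_abs hj')).trans
          (Finset.single_le_sum (fun k _ => sq_nonneg ((x k : ℤ) : ℝ)) (Finset.mem_univ j))
      rw [← mul_div_assoc, div_le_div_iff₀ (by linarith) (by linarith)]
      nlinarith [sq_nonneg (f x), mul_nonneg (sq_nonneg (f x)) (by linarith : (0 : ℝ) ≤ ∑ k, ((x k : ℤ) : ℝ) ^ 2 - 1)]
  have hTl : ∀ x ∉ T, (if x = 0 then (0 : ℝ) else f x ^ 2 / ∑ j, ((x j : ℤ) : ℝ) ^ 2) = 0 := fun x hx => by simp [hT x hx]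
  have hTr : ∀ x ∉ T, (3 * (d : ℝ) + 1) * (f x ^ 2 / ((∑ j, ((x j : ℤ) : ℝ) ^ 2) + 3 * d)) = 0 := fun x hx => by simp [hT x hx]
  have hle : ∑' x, (if x = 0 then (0 : ℝ) else f x ^ 2 / ∑ j, ((x j : ℤ) : ℝ) ^ 2)
      ≤ ∑' x, (3 * (d : ℝ) + 1) * (f x ^ 2 / ((∑ j, ((x j : ℤ) : ℝ) ^ 2) + 3 * d)) :=
    Summable.tsum_le_tsum hterm (summable_of_ne_finset_zero hTl) (summable_of_ne_finset_zero hTr)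
  rw [tsum_mul_left] at hle
  calc ∑' x, (if x = 0 then (0 : ℝ) else f x ^ 2 / ∑ j, ((x j : ℤ) : ℝ) ^ 2)
      ≤ (3 * (d : ℝ) + 1) * ∑' x, f x ^ 2 / ((∑ j, ((x j : ℤ) : ℝ) ^ 2) + 3 * d) := hle
    _ ≤ (3 * (d : ℝ) + 1) * (128 / ((d : ℝ) - 2) ^ 2 * ∑' x, ∑ i, (f (x + Pi.single i (1 : ℤ)) - f x) ^ 2) :=
        mul_le_mul_of_nonneg_left (discrete_hardy_lattice hd f T hT) (by linarith)
    _ = 128 * (3 * d + 1) / ((d : ℝ) - 2) ^ 2 * ∑' x, ∑ i, (f (x + Pi.single i (1 : ℤ)) - f x) ^ 2 := by ring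

end Literature.Analysis.FunctionSpaces

end
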